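import Literature.Geometry.Kaehler.ComplexTorusWeilPeriod
import Literature.Geometry.Kaehler.ComplexTorusCoordForms
import Literature.Geometry.Kaehler.ComplexTorusZuckerJ
import HarnessLib

/-!
# `NS = 0` for the explicit complex torus of Weil type

Companion of `Literature/Geometry/Kaehler/ComplexTorusWeilPeriod.lean` (the explicit period
isomorphism `Φ = Weil.periodEquiv : ℝ⁸ ≃ ℂ⁴` with transcendental period `t`) and
`ComplexTorusCoordForms.lean` (the lattice-coordinate forms `ε_{ab}`, whose `ℚ`-span is the space
of rational invariant `2`-forms of the torus `X = ℂ⁴/Φ(ℤ⁸)`). C. Voisin, IMRN 2002 no. 20, §3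
Prop. 3 (i): "For a general `X` as above, `NS(X) = 0`", proved there via Hodge loci from the
algebraic case (Weil; van Geemen Thm. 4.11). Here the statement is PROVED for the one explicit very
general torus of `ComplexTorusWeilPeriod`, in the form used by the discharge programme of the
barrier fact `Literature.Barriers.HodgeConjecture.Voisin2002_weilTorus_hodgeClassWithoutSubvarieties`:

* `Weil.eq_zero_of_mem_span_coordForm_of_smul_I`: **a rational invariant `2`-form of type `(1,1)`
  (`γ₀(iu, iv) = γ₀(u, v)`) on `X` is zero** — `NS(X) ⊗ ℚ = 0` on invariant forms.

## Proof (transcendence)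

If `γ₀` is `i`-invariant, its complex-bilinear extension vanishes on `W × W`, `W = ker Φ_ℂ ⊂ ℂ⁸`
(`Weil.kerPair`: for `U + iV = 0 = U' + iV'`, `γ₀(U, U') = γ₀(V, V')` and
`γ₀(U, V') + γ₀(V, U') = 0`). `W` contains four explicit vectors `x_j + i y_j` read off from the
graphs of `-T₁`, `-T₂` (`Weil.ker_pair_one` … `ker_pair_four`). In the `28` rational lattice
coordinates `q_{ab} = γ₀(Φe_a, Φe_b)` each resulting identity reads `∑ αₙ tⁿ = 0` over finitely many
DISTINCT powers of `t` with `αₙ ∈ ℚ` linear in `q`; since `t` is transcendental all `αₙ` vanish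
(`Weil.eq_zero_of_sum_mul_pow_eq_zero`), and the `37` equations from the pairs `(1,2)`, `(1,3)`,
`(2,4)` give `q = 0`. (The exponents of `T₁ = (t, t²; t³, t⁵)`, `T₂ = (t¹⁰, t²⁰; t³⁰, t⁵⁰)` were
chosen so that no two monomials collide.)

No definition and no named fact is introduced.

## References

* C. Voisin, IMRN 2002 no. 20, 1057–1075 (arXiv:math/0112247), §2 (a), §3 pp. 5–6, Prop. 3.
  [Voisin2002KaehlerCounterexample]
* B. van Geemen, in LNM 1594 (1994), Thm. 4.11, §5. [vanGeemen1994HodgeAV]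
-/

noncomputable section

open scoped ComplexConjugate
open Polynomial

namespace Literature.Geometry.Kaehler

namespace Weil

/-! ### Transcendence: finitely many distinct powers of `t` are linearly independent over `ℚ` -/

/-- **Distinct powers of a transcendental number are `ℚ`-linearly independent**: if
`∑_{n ∈ S} αₙ tⁿ = 0` with `αₙ ∈ ℚ` then all `αₙ = 0` (the polynomial `∑ αₙ Xⁿ` has `t` as a
root). [folklore] -/
theorem eq_zero_of_sum_mul_pow_eq_zero {t : ℂ} (ht : Transcendental ℚ t) (S : Finset ℕ)
    (α : ℕ → ℚ) (h : ∑ n ∈ S, (α n : ℂ) * t ^ n = 0) : ∀ n ∈ S, α n = 0 := by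
  classical
  set P : ℚ[X] := ∑ n ∈ S, C (α n) * X ^ n with hP
  have hPt : aeval t P = 0 := by
    rw [hP, map_sum]
    simp only [map_mul, aeval_C, aeval_X_pow, eq_ratCast]
    exact h
  have hP0 : P = 0 := (transcendental_iff.1 ht) P hPt
  intro n hn
  have hc := congrArg (fun Q : ℚ[X] ↦ Q.coeff n) hP0
  simp only [hP, finsetSum_coeff, coeff_C_mul_X_pow, coeff_zero] at hc
  rwa [Finset.sum_ite_eq, if_pos hn] at hc

/-! ### The lattice basis in `ℂ⁴` -/

/-- **The images of the lattice basis** `Φ(e_k)`, `k = 0, …, 7`, under the period isomorphism: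
the columns of the period matrix. [cite: Voisin2002KaehlerCounterexample, §3 p. 5] -/
theorem periodEquiv_single (k : Fin 8) :
    periodEquiv (Pi.single k (1 : ℝ)) =
      ![![1, 0, (tV : ℂ) ^ 10, (tV : ℂ) ^ 30],
        ![Complex.I, 0, -(Complex.I * (tV : ℂ) ^ 10), -(Complex.I * (tV : ℂ) ^ 30)],
        ![0, 1, (tV : ℂ) ^ 20, (tV : ℂ) ^ 50],
        ![0, Complex.I, -(Complex.I * (tV : ℂ) ^ 20), -(Complex.I * (tV : ℂ) ^ 50)],
        ![(tV : ℂ), (tV : ℂ) ^ 3, 1, 0],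
        ![Complex.I * tV, Complex.I * (tV : ℂ) ^ 3, -Complex.I, 0],
        ![(tV : ℂ) ^ 2, (tV : ℂ) ^ 5, 0, 1],
        ![Complex.I * (tV : ℂ) ^ 2, Complex.I * (tV : ℂ) ^ 5, 0, -Complex.I]] k := by
  rw [periodEquiv_apply, periodMap_apply]
  fin_cases k <;>
  · funext j
    fin_cases j <;> apply Complex.ext <;> simp

/-! ### Pairs of complexified lattice vectors in `W = ker Φ_ℂ` -/

/-- **The key bilinear identity.** Let `γ` be an `i`-invariant alternating real `2`-form on a
complex vector space (`γ(iu, iv) = γ(u, v)`, i.e. `γ` of type `(1,1)`). If `U + iV = 0` and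
`U' + iV' = 0` — i.e. `U + iV`-type vectors of the complexification lie in `V^{0,1}`-position —
then `γ(U, U') = γ(V, V')` and `γ(U, V') + γ(V, U') = 0`: the complex-bilinear extension of `γ`
vanishes on pairs of such vectors (the real and imaginary parts of `γ_ℂ(V - iU… )`). This is the
classical "a `(1,1)`-form vanishes on `W × W`" for `W = H^{1,0}`-type subspaces
(Lange–Birkenhake (1992), §1.2 / Voisin (2002), §3: `H^{1,1} = W^* ⊗ W̄^*`).
[cite: Voisin2002KaehlerCounterexample, §3 p. 6] -/
theorem kerPair {E : Type*} [NormedAddCommGroup E] [NormedSpace ℂ E]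
    (γ : E [⋀^Fin 2]→L[ℝ] ℂ) (h11 : ∀ u v : E, γ ![Complex.I • u, Complex.I • v] = γ ![u, v])
    {U V U' V' : E} (hU : U + Complex.I • V = 0) (hU' : U' + Complex.I • V' = 0) :
    γ ![U, U'] = γ ![V, V'] ∧ γ ![U, V'] + γ ![V, U'] = 0 := by
  have eU : U = -(Complex.I • V) := eq_neg_of_add_eq_zero_left hU
  have eU' : U' = -(Complex.I • V') := eq_neg_of_add_eq_zero_left hU'
  have hII : ∀ w : E, Complex.I • (Complex.I • w) = -w := fun w ↦ by
    rw [smul_smul, Complex.I_mul_I, neg_one_smul]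
  constructor
  · rw [eU, eU', Zucker.alt_neg₀, Zucker.alt_neg₁, neg_neg, h11]
  · rw [eU, eU', Zucker.alt_neg₀, Zucker.alt_neg₁]
    have h1 : γ ![Complex.I • V, V'] = -γ ![V, Complex.I • V'] := by
      have h2 := h11 V (-(Complex.I • V'))
      rw [smul_neg, hII, neg_neg] at h2
      rw [h2, Zucker.alt_neg₁]
    rw [h1]
    ring

/-- The four pairs of real vectors `(x_j, y_j)` with `Φ x_j + i Φ y_j = 0` used below are read off
from Voisin's `W = W_i ⊕ W_{-i}`: in the coordinates `ζ` of `ℂ²_i ⊕ ℂ²_{-i}`-type, `W` is the graph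
of `-T₁` on the `ζ`-side and of `-T₂` on the `ζ̄`-side. First pair:
`x₁ = -t e₀ - t³ e₂ + e₄`, `y₁ = t e₁ + t³ e₃ - e₅`. [cite: Voisin2002KaehlerCounterexample, §3 p. 5] -/
theorem ker_pair_one :
    periodEquiv ((-tV) • Pi.single 0 1 + (-tV ^ 3) • Pi.single 2 1 + Pi.single 4 1) +
      Complex.I • periodEquiv (tV • Pi.single 1 1 + (tV ^ 3) • Pi.single 3 1 - Pi.single 5 1) = 0 := by
  simp only [map_add, map_sub, map_smul, periodEquiv_single]
  funext j
  fin_cases j <;> apply Complex.ext <;> simp <;> ring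

/-- Second pair: `x₂ = -t² e₀ - t⁵ e₂ + e₆`, `y₂ = t² e₁ + t⁵ e₃ - e₇`.
[cite: Voisin2002KaehlerCounterexample, §3 p. 5] -/
theorem ker_pair_two :
    periodEquiv ((-tV ^ 2) • Pi.single 0 1 + (-tV ^ 5) • Pi.single 2 1 + Pi.single 6 1) +
      Complex.I • periodEquiv ((tV ^ 2) • Pi.single 1 1 + (tV ^ 5) • Pi.single 3 1 - Pi.single 7 1) = 0 := by
  simp only [map_add, map_sub, map_smul, periodEquiv_single]
  funext j
  fin_cases j <;> apply Complex.ext <;> simp <;> ring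

/-- Third pair: `x₃ = e₀ - t¹⁰ e₄ - t³⁰ e₆`, `y₃ = e₁ - t¹⁰ e₅ - t³⁰ e₇`.
[cite: Voisin2002KaehlerCounterexample, §3 p. 5] -/
theorem ker_pair_three :
    periodEquiv (Pi.single 0 1 + (-tV ^ 10) • Pi.single 4 1 + (-tV ^ 30) • Pi.single 6 1) +
      Complex.I • periodEquiv (Pi.single 1 1 + (-tV ^ 10) • Pi.single 5 1 + (-tV ^ 30) • Pi.single 7 1) = 0 := by
  simp only [map_add, map_smul, periodEquiv_single]
  funext j
  fin_cases j <;> apply Complex.ext <;> simp <;> ring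

/-- Fourth pair: `x₄ = e₂ - t²⁰ e₄ - t⁵⁰ e₆`, `y₄ = e₃ - t²⁰ e₅ - t⁵⁰ e₇`.
[cite: Voisin2002KaehlerCounterexample, §3 p. 5] -/
theorem ker_pair_four :
    periodEquiv (Pi.single 2 1 + (-tV ^ 20) • Pi.single 4 1 + (-tV ^ 50) • Pi.single 6 1) +
      Complex.I • periodEquiv (Pi.single 3 1 + (-tV ^ 20) • Pi.single 5 1 + (-tV ^ 50) • Pi.single 7 1) = 0 := by
  simp only [map_add, map_smul, periodEquiv_single]
  funext j
  fin_cases j <;> apply Complex.ext <;> simp <;> ring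

/-! ### `NS_ℚ = 0`: no non-zero rational invariant form of type `(1,1)` on the explicit torus -/

set_option maxHeartbeats 400000 in
/-- **`NS(X) ⊗ ℚ = 0` for the explicit Weil torus, on invariant forms.** Let `γ₀ ∈ Alt²_ℝ(ℂ⁴; ℂ)`
be a RATIONAL invariant form of the torus `X = ℂ⁴/Φ(ℤ⁸)`, `Φ = periodEquiv` (a `ℚ`-combination of
the lattice-coordinate forms `ε_{ab}`), which is `i`-invariant (`γ₀(iu, iv) = γ₀(u, v)`, i.e. of
type `(1,1)`). Then `γ₀ = 0`. Proof: by `kerPair` the complex-bilinear extension of `γ₀` vanishes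
on the pairs of vectors `x_j + i y_j ∈ ker Φ_ℂ = W` (`ker_pair_one` … `ker_pair_four`); written in
the `28` rational lattice coordinates `q_{ab} = γ₀(Φe_a, Φe_b)` of `γ₀`, each of the resulting
identities is `∑ αₙ tⁿ = 0` for finitely many DISTINCT powers of the transcendental period `t` with
coefficients `αₙ ∈ ℚ` linear in the `q_{ab}`, so all `αₙ` vanish
(`eq_zero_of_sum_mul_pow_eq_zero`); the `37` linear equations so obtained from the pairs
`(1,2), (1,3), (2,4)` force `q = 0`. This is Voisin's `NS(X) = 0` for the general torus of Weil
type (Prop. 3 (i)), here for one explicit very general member, with transcendence of `t` replacing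
"general". [cite: Voisin2002KaehlerCounterexample, §2 (a) and §3 Prop. 3] -/
theorem eq_zero_of_mem_span_coordForm_of_smul_I (γ₀ : (Fin 4 → ℂ) [⋀^Fin 2]→L[ℝ] ℂ)
    (hspan : γ₀ ∈ Submodule.span ℚ (Set.range fun p : ComplexTorus.Pairs (Fin 8) ↦
      ComplexTorus.coordForm periodEquiv p.1.1 p.1.2))
    (h11 : ∀ u v : Fin 4 → ℂ, γ₀ ![Complex.I • u, Complex.I • v] = γ₀ ![u, v]) : γ₀ = 0 := by
  classical
  obtain ⟨q, hq⟩ := (Submodule.mem_span_range_iff_exists_fun ℚ).1 hspan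
  -- `γ₀` in the basis `ε_{ab}`, `a < b`
  have hγ : γ₀ = ∑ p, ((q p : ℚ) : ℂ) • ComplexTorus.coordFormBasis periodEquiv p := by
    rw [← hq]
    refine Finset.sum_congr rfl fun p _ ↦ ?_
    rw [ComplexTorus.coordFormBasis_apply, Rat.cast_smul_eq_qsmul]
  have hrepr : ∀ p, (ComplexTorus.coordFormBasis periodEquiv).repr γ₀ p = ((q p : ℚ) : ℂ) :=
    fun p ↦ by rw [hγ, Module.Basis.repr_sum_self]
  -- the rational lattice coordinates `Q a b` (`= q_{ab}` for `a < b`, `0` otherwise)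
  set Q : Fin 8 → Fin 8 → ℚ := fun k l ↦ if h : k < l then q ⟨(k, l), h⟩ else 0 with hQ
  have hval : ∀ k l : Fin 8, γ₀ ![periodEquiv (Pi.single k 1), periodEquiv (Pi.single l 1)] =
      (Q k l : ℂ) - (Q l k : ℂ) := by
    intro k l
    rcases lt_trichotomy k l with hkl | rfl | hlk
    · have h := ComplexTorus.coordFormBasis_repr periodEquiv γ₀ ⟨(k, l), hkl⟩
      rw [hrepr] at h
      rw [← h]
      simp [hQ, hkl, not_lt_of_gt hkl]
    · rw [Zucker.alt_self]
      simp [hQ]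
    · have h := ComplexTorus.coordFormBasis_repr periodEquiv γ₀ ⟨(l, k), hlk⟩
      rw [hrepr] at h
      rw [Zucker.alt_swap, ← h]
      simp [hQ, hlk, not_lt_of_gt hlk]
  set t : ℂ := (tV : ℂ) with ht
  have htr : Transcendental ℚ t := transcendental_tV_complex
  -- the bilinear identities from the pairs of kernel vectors, in lattice coordinates
  have P12 := kerPair γ₀ h11 ker_pair_one ker_pair_two
  have P13 := kerPair γ₀ h11 ker_pair_one ker_pair_three
  have P24 := kerPair γ₀ h11 ker_pair_two ker_pair_four
  simp only [map_add, map_sub, map_smul] at P12 P13 P24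
  simp only [sub_eq_add_neg, Zucker.alt_add₀, Zucker.alt_add₁, Zucker.alt_smul₀,
    Zucker.alt_smul₁, Zucker.alt_neg₀, Zucker.alt_neg₁, hval, Complex.real_smul,
    Complex.ofReal_neg, Complex.ofReal_pow] at P12 P13 P24
  obtain ⟨Re12, Im12⟩ := P12
  obtain ⟨Re13, Im13⟩ := P13
  obtain ⟨-, Im24⟩ := P24
  simp only [hQ] at Re12 Im12 Re13 Im13 Im24
  simp only [Fin.isValue, Fin.reduceLT, dite_true, dite_false, Rat.cast_zero]
    at Re12 Im12 Re13 Im13 Im24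
  -- the five polynomial identities `∑ αₙ tⁿ = 0` and their coefficients
  set α12 : ℕ → ℚ := fun n ↦ if n = 0 then Q 4 6 - Q 5 7 else if n = 1 then -Q 0 6 + Q 1 7
    else if n = 2 then Q 0 4 - Q 1 5 else if n = 3 then -Q 2 6 + Q 3 7
    else if n = 5 then -Q 0 2 + Q 1 3 + Q 2 4 - Q 3 5 else Q 0 2 - Q 1 3 with hα12
  have key12 : ∑ n ∈ ({0, 1, 2, 3, 5, 6} : Finset ℕ), ((α12 n : ℚ) : ℂ) * t ^ n = 0 := by
    norm_num [hα12, hQ]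
    push_cast
    linear_combination Re12
  set β12 : ℕ → ℚ := fun n ↦ if n = 0 then -Q 4 7 - Q 5 6 else if n = 1 then Q 0 7 + Q 1 6
    else if n = 2 then -Q 0 5 - Q 1 4 else if n = 3 then Q 2 7 + Q 3 6
    else if n = 5 then Q 0 3 + Q 1 2 - Q 2 5 - Q 3 4 else -Q 0 3 - Q 1 2 with hβ12
  have key12' : ∑ n ∈ ({0, 1, 2, 3, 5, 6} : Finset ℕ), ((β12 n : ℚ) : ℂ) * t ^ n = 0 := by
    norm_num [hβ12, hQ]
    push_cast
    linear_combination Im12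
  set α13 : ℕ → ℚ := fun n ↦ if n = 0 then -Q 0 4 - Q 1 5 else if n = 3 then Q 0 2 + Q 1 3
    else if n = 11 then Q 0 4 + Q 1 5 else if n = 13 then Q 2 4 + Q 3 5
    else if n = 30 then -Q 4 6 - Q 5 7 else if n = 31 then Q 0 6 + Q 1 7
    else Q 2 6 + Q 3 7 with hα13
  have key13 : ∑ n ∈ ({0, 3, 11, 13, 30, 31, 33} : Finset ℕ), ((α13 n : ℚ) : ℂ) * t ^ n = 0 := by
    norm_num [hα13, hQ]
    push_cast
    linear_combination Re13
  set β13 : ℕ → ℚ := fun n ↦ if n = 0 then Q 0 5 - Q 1 4 else if n = 1 then -2 * Q 0 1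
    else if n = 3 then -Q 0 3 + Q 1 2 else if n = 10 then -2 * Q 4 5
    else if n = 11 then Q 0 5 - Q 1 4 else if n = 13 then Q 2 5 - Q 3 4
    else if n = 30 then -Q 4 7 + Q 5 6 else if n = 31 then Q 0 7 - Q 1 6
    else Q 2 7 - Q 3 6 with hβ13
  have key13' : ∑ n ∈ ({0, 1, 3, 10, 11, 13, 30, 31, 33} : Finset ℕ),
      ((β13 n : ℚ) : ℂ) * t ^ n = 0 := by
    norm_num [hβ13, hQ]
    push_cast
    linear_combination Im13
  set β24 : ℕ → ℚ := fun n ↦ if n = 0 then Q 2 7 - Q 3 6 else if n = 2 then -Q 0 3 + Q 1 2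
    else if n = 5 then -2 * Q 2 3 else if n = 20 then -Q 4 7 + Q 5 6
    else if n = 22 then Q 0 5 - Q 1 4 else if n = 25 then Q 2 5 - Q 3 4
    else if n = 50 then -2 * Q 6 7 else if n = 52 then Q 0 7 - Q 1 6
    else Q 2 7 - Q 3 6 with hβ24
  have key24 : ∑ n ∈ ({0, 2, 5, 20, 22, 25, 50, 52, 55} : Finset ℕ),
      ((β24 n : ℚ) : ℂ) * t ^ n = 0 := by
    norm_num [hβ24, hQ]
    push_cast
    linear_combination Im24
  -- extraction of the `37` coefficient equations
  have A := eq_zero_of_sum_mul_pow_eq_zero htr _ _ key12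
  have B := eq_zero_of_sum_mul_pow_eq_zero htr _ _ key12'
  have C := eq_zero_of_sum_mul_pow_eq_zero htr _ _ key13
  have D := eq_zero_of_sum_mul_pow_eq_zero htr _ _ key13'
  have F := eq_zero_of_sum_mul_pow_eq_zero htr _ _ key24
  have a0 := A 0 (by simp); have a1 := A 1 (by simp); have a2 := A 2 (by simp)
  have a3 := A 3 (by simp); have a5 := A 5 (by simp); have a6 := A 6 (by simp)
  have b0 := B 0 (by simp); have b1 := B 1 (by simp); have b2 := B 2 (by simp)
  have b3 := B 3 (by simp); have b5 := B 5 (by simp); have b6 := B 6 (by simp)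
  have c0 := C 0 (by simp); have c3 := C 3 (by simp); have c11 := C 11 (by simp)
  have c13 := C 13 (by simp); have c30 := C 30 (by simp); have c31 := C 31 (by simp)
  have c33 := C 33 (by simp)
  have d0 := D 0 (by simp); have d1 := D 1 (by simp); have d3 := D 3 (by simp)
  have d10 := D 10 (by simp); have d11 := D 11 (by simp); have d13 := D 13 (by simp)
  have d30 := D 30 (by simp); have d31 := D 31 (by simp); have d33 := D 33 (by simp)
  have f0 := F 0 (by simp); have f2 := F 2 (by simp); have f5 := F 5 (by simp)
  have f20 := F 20 (by simp); have f22 := F 22 (by simp); have f25 := F 25 (by simp)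
  have f50 := F 50 (by simp); have f52 := F 52 (by simp); have f55 := F 55 (by simp)
  norm_num [hα12] at a0 a1 a2 a3 a5 a6
  norm_num [hβ12] at b0 b1 b2 b3 b5 b6
  norm_num [hα13] at c0 c3 c11 c13 c30 c31 c33
  norm_num [hβ13] at d0 d1 d3 d10 d11 d13 d30 d31 d33
  norm_num [hβ24] at f0 f2 f5 f20 f22 f25 f50 f52 f55
  -- all `28` lattice coordinates vanish
  have h46 : Q 4 6 = 0 := by linear_combination (a0 - c30) / 2
  have h57 : Q 5 7 = 0 := by linear_combination (-a0 - c30) / 2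
  have h17 : Q 1 7 = 0 := by linear_combination (a1 + c31) / 2
  have h06 : Q 0 6 = 0 := by linear_combination (c31 - a1) / 2
  have h04 : Q 0 4 = 0 := by linear_combination (a2 - c0) / 2
  have h15 : Q 1 5 = 0 := by linear_combination (-a2 - c0) / 2
  have h37 : Q 3 7 = 0 := by linear_combination (a3 + c33) / 2
  have h26 : Q 2 6 = 0 := by linear_combination (c33 - a3) / 2
  have h02 : Q 0 2 = 0 := by linear_combination (a6 + c3) / 2
  have h13 : Q 1 3 = 0 := by linear_combination (c3 - a6) / 2
  have h24 : Q 2 4 = 0 := by linear_combination (a5 + a6 + c13) / 2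
  have h35 : Q 3 5 = 0 := by linear_combination (c13 - a5 - a6) / 2
  have h47 : Q 4 7 = 0 := by linear_combination (-b0 - d30) / 2
  have h56 : Q 5 6 = 0 := by linear_combination (d30 - b0) / 2
  have h07 : Q 0 7 = 0 := by linear_combination (b1 + d31) / 2
  have h16 : Q 1 6 = 0 := by linear_combination (b1 - d31) / 2
  have h05 : Q 0 5 = 0 := by linear_combination (d0 - b2) / 2
  have h14 : Q 1 4 = 0 := by linear_combination (-b2 - d0) / 2
  have h27 : Q 2 7 = 0 := by linear_combination (b3 + d33) / 2
  have h36 : Q 3 6 = 0 := by linear_combination (b3 - d33) / 2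
  have h12 : Q 1 2 = 0 := by linear_combination (d3 - b6) / 2
  have h03 : Q 0 3 = 0 := by linear_combination (-b6 - d3) / 2
  have h25 : Q 2 5 = 0 := by linear_combination (-b5 - b6 + d13) / 2
  have h34 : Q 3 4 = 0 := by linear_combination (-b5 - b6 - d13) / 2
  have h01 : Q 0 1 = 0 := d1
  have h45 : Q 4 5 = 0 := d10
  have h23 : Q 2 3 = 0 := f5
  have h67 : Q 6 7 = 0 := f50
  have hall : ∀ k l : Fin 8, k < l → Q k l = 0 := by
    intro k l
    fin_cases k <;> fin_cases l <;>
      first | (intro; assumption) | (intro h; exact absurd h (by decide))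
  -- hence `γ₀ = 0`
  refine (ComplexTorus.coordFormBasis periodEquiv).ext_elem fun p ↦ ?_
  rw [map_zero, Finsupp.zero_apply, hrepr]
  obtain ⟨⟨k, l⟩, hkl⟩ := p
  have hq0 : q ⟨(k, l), hkl⟩ = Q k l := by simp [hQ, hkl]
  rw [hq0, hall k l hkl, Rat.cast_zero]


end Weil

end Literature.Geometry.Kaehler

end
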